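import Summits.AtomisticToContinuum.Crystallization.Theorems.ContactSaturationLadderHoleDepth
import HarnessLib

/-!
# Density floor from void-freeness (lens-1 «grading», gen 16; helper for `ContactSaturationLadder.LooseTextureRung`, stmt-30303)

The residual world of the ContactSaturationLadder lineage (pieces P1 `ThinClusterFloor`, P3 `BulkGapCertificate`, FAR′/NEAR′ of the
g16 node «DialFreeSieve») consists of windows `B(c,ρ)` whose doubled ball is **2-void-free**: no particle `y i` with `dist (y i) c ≤ 2ρ`
has an empty unit ball centred within `2` of it — spelled in the route's stub texts as
`i ∉ (Finset.univ.filter fun i => ∃ x, dist x (y i) ≤ 2 ∧ ∀ j, 1 ≤ dist x (y j))`.  This file proves the elementary DENSITY FLOOR such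
windows enjoy, ground-state-free:

* `exists_dist_lt_one_of_voidFree` — DESCENT: if the particles within `r₀` of a point `w` are void-free in the above sense and some
  particle lies within `r₀` of `w`, then some particle lies within distance `< 1` of `w` (walk towards `w` in steps of `2`, gaining `≥ 1`).
* `exists_dist_lt_one_of_window_voidFree` — COVERING: on a void-free doubled window that meets the configuration, every point of
  `B(c, ρ − 1/2)` is within `< 1` of a particle.
* `card_window_ge_of_voidFree` — **DENSITY FLOOR** (Lebesgue volume, as `ContactSaturationLadderWindowFilling.card_window_ge`):
  `(R − 1)³ ≤ #{i : dist (y i) c ≤ R}` whenever the particles of `B(c,2R)` are void-free and some particle lies in `B(c, 2R − 1)`;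
  `card_window_ge_of_not_voidAdj` is the same with the hypothesis in the route's literal `∉ filter` form and «the window meets the
  configuration».
* `card_outer_le_mul_card_inner` — with a separation `δ > 0` on top (every Lennard-Jones ground state has one:
  `SeparationCeilingDoor.sepGS_pos`), the SANDWICH `(R − 1)³ · #B(c, R′) ≤ (2R′/δ + 1)³ · #B(c, R)` for `R ≤ R′`: outer windows and collars
  are comparable to inner windows — the bookkeeping constant every per-defect ÷ brush-count price estimate of the lineage divides by
  (critic RULING 2026-08-30 (3); brush count = `ContactSaturationLadderHoleDepth.card_le_mul_card_of_brushed`).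

All statements are over Mathlib and tree declarations only; no new definitions.
-/

noncomputable section

open scoped Classical
open Metric MeasureTheory

namespace Summit.AtomisticToContinuum.Crystallization.Theorems.ContactSaturationLadderDensityFloor

/-! ## §1 Descent and covering -/

/-- **Descent.**  If every particle within `r₀` of `w` sees a particle within `< 1` of every point at distance `≤ 2` from it, and some
particle lies within `r₀` of `w`, then some particle lies within `< 1` of `w`. [folklore] -/
theorem exists_dist_lt_one_of_voidFree {N : ℕ} (y : Fin N → EuclideanSpace ℝ (Fin 3)) (w : EuclideanSpace ℝ (Fin 3)) {r₀ : ℝ}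
    (hv : ∀ i : Fin N, dist (y i) w ≤ r₀ → ∀ x : EuclideanSpace ℝ (Fin 3), dist x (y i) ≤ 2 → ∃ j : Fin N, dist x (y j) < 1)
    (h0 : ∃ i : Fin N, dist (y i) w ≤ r₀) : ∃ j : Fin N, dist w (y j) < 1 := by
  have key : ∀ n : ℕ, ∀ i : Fin N, dist (y i) w ≤ r₀ → dist (y i) w ≤ n → ∃ j : Fin N, dist w (y j) < 1 := by
    intro n
    induction n with
    | zero =>
      intro i hi hn
      refine hv i hi w ?_
      have := dist_nonneg (x := y i) (y := w)
      rw [dist_comm]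
      push_cast at hn
      linarith
    | succ n ih =>
      intro i hi hn
      by_cases h2 : dist (y i) w ≤ 2
      · exact hv i hi w (by rwa [dist_comm])
      · push Not at h2
        set d : ℝ := dist (y i) w with hd
        have hdpos : 0 < d := by linarith
        set t : ℝ := 2 / d with ht
        have htpos : 0 < t := by positivity
        have ht1 : t < 1 := by rw [ht, div_lt_one hdpos]; exact h2
        set x : EuclideanSpace ℝ (Fin 3) := y i + t • (w - y i) with hx
        have hxi : dist x (y i) = 2 := by
          have h1 : x - y i = t • (w - y i) := by rw [hx]; abel
          rw [dist_eq_norm, h1, norm_smul, Real.norm_eq_abs, abs_of_pos htpos, ← dist_eq_norm, dist_comm, ← hd, ht]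
          field_simp
        have hxw : dist x w = d - 2 := by
          have h1 : x - w = (1 - t) • (y i - w) := by
            simp only [hx, sub_smul, one_smul, smul_sub]
            abel
          rw [dist_eq_norm, h1, norm_smul, Real.norm_eq_abs, abs_of_pos (by linarith), ← dist_eq_norm, ← hd, ht]
          field_simp
        obtain ⟨j, hj⟩ := hv i hi x hxi.le
        have hjw : dist (y j) w < d - 1 := by
          have := dist_triangle (y j) x w
          rw [dist_comm (y j) x] at this
          linarith
        have hjn : dist (y j) w ≤ n := by
          push_cast at hn
          linarith
        exact ih j (by linarith) hjn
  obtain ⟨i, hi⟩ := h0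
  obtain ⟨n, hn⟩ := exists_nat_ge (dist (y i) w)
  exact key n i hi hn

/-- **Covering.**  If the particles of the doubled window `B(c,2ρ)` are void-free and the doubled window meets the configuration,
then every point of `B(c, ρ − 1/2)` lies within `< 1` of a particle. [folklore] -/
theorem exists_dist_lt_one_of_window_voidFree {N : ℕ} (y : Fin N → EuclideanSpace ℝ (Fin 3)) (c : EuclideanSpace ℝ (Fin 3))
    {ρ : ℝ}
    (hv : ∀ i : Fin N, dist (y i) c ≤ 2 * ρ → ∀ x : EuclideanSpace ℝ (Fin 3), dist x (y i) ≤ 2 → ∃ j : Fin N, dist x (y j) < 1)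
    (h0 : ∃ i : Fin N, dist (y i) c ≤ 2 * ρ) (z : EuclideanSpace ℝ (Fin 3)) (hz : dist z c ≤ ρ - 1 / 2) :
    ∃ j : Fin N, dist z (y j) < 1 := by
  obtain ⟨j₀, hj₀⟩ := exists_dist_lt_one_of_voidFree y c (r₀ := 2 * ρ) hv h0
  refine exists_dist_lt_one_of_voidFree y z (r₀ := ρ + 1 / 2) ?_ ⟨j₀, ?_⟩
  · intro i hi x hx
    refine hv i ?_ x hx
    have := dist_triangle (y i) z c
    linarith
  · have := dist_triangle (y j₀) c z
    rw [dist_comm (y j₀) c, dist_comm c z] at this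
    linarith

/-! ## §2 The density floor (Lebesgue volume) -/

/-- **DENSITY FLOOR from void-freeness.**  If the particles of `B(c,2R)` are void-free (`R ≥ 1`) and some particle lies in
`B(c, 2R − 1)`, then `(R − 1)³ ≤ #{i : dist (y i) c ≤ R}` — the unit balls about the window's particles cover `B̄(c, R − 1)`.
[folklore] -/
theorem card_window_ge_of_voidFree {N : ℕ} (y : Fin N → EuclideanSpace ℝ (Fin 3)) (c : EuclideanSpace ℝ (Fin 3)) {R : ℝ}
    (hR : 1 ≤ R)
    (hv : ∀ i : Fin N, dist (y i) c ≤ 2 * R → ∀ x : EuclideanSpace ℝ (Fin 3), dist x (y i) ≤ 2 → ∃ j : Fin N, dist x (y j) < 1)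
    (h0 : ∃ i : Fin N, dist (y i) c ≤ 2 * R - 1) :
    (R - 1) ^ 3 ≤ ((Finset.univ.filter fun i : Fin N => dist (y i) c ≤ R).card : ℝ) := by
  have hv' : ∀ i : Fin N, dist (y i) c ≤ 2 * (R - 1 / 2) →
      ∀ x : EuclideanSpace ℝ (Fin 3), dist x (y i) ≤ 2 → ∃ j : Fin N, dist x (y j) < 1 :=
    fun i hi => hv i (by linarith)
  have h0' : ∃ i : Fin N, dist (y i) c ≤ 2 * (R - 1 / 2) := by
    obtain ⟨i, hi⟩ := h0
    exact ⟨i, by linarith⟩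
  set W := Finset.univ.filter (fun i : Fin N => dist (y i) c ≤ R) with hW
  have hcov : closedBall c (R - 1) ⊆ ⋃ i ∈ W, ball (y i) 1 := by
    intro q hq
    rw [mem_closedBall] at hq
    obtain ⟨j, hj⟩ := exists_dist_lt_one_of_window_voidFree y c hv' h0' q (by linarith)
    have hjW : j ∈ W := by
      refine Finset.mem_filter.2 ⟨Finset.mem_univ _, ?_⟩
      have := dist_triangle (y j) q c
      rw [dist_comm (y j) q] at this
      linarith
    exact Set.mem_biUnion hjW (by rw [mem_ball]; exact hj)
  have hfin : volume (⋃ i ∈ W, ball (y i) (1 : ℝ)) ≠ ⊤ := by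
    refine (lt_of_le_of_lt (measure_biUnion_finset_le W fun i => ball (y i) (1 : ℝ)) ?_).ne
    rw [ENNReal.sum_lt_top]
    exact fun i _ => measure_ball_lt_top
  have hvol := measureReal_mono (μ := volume) hcov hfin
  have h1 : volume.real (closedBall c (R - 1)) = (R - 1) ^ 3 * volume.real (ball (0 : EuclideanSpace ℝ (Fin 3)) 1) := by
    rw [Measure.addHaar_real_closedBall _ _ (by linarith), finrank_euclideanSpace_fin]
  have h2 : volume.real (⋃ i ∈ W, ball (y i) (1 : ℝ)) ≤ ∑ i ∈ W, volume.real (ball (y i) (1 : ℝ)) :=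
    measureReal_biUnion_finset_le W _
  have h3 : ∀ i ∈ W, volume.real (ball (y i) (1 : ℝ)) = volume.real (ball (0 : EuclideanSpace ℝ (Fin 3)) 1) := by
    intro i _
    rw [← Measure.addHaar_real_closedBall_eq_addHaar_real_ball volume (y i) 1, Measure.addHaar_real_closedBall _ _ zero_le_one,
      finrank_euclideanSpace_fin, one_pow, one_mul]
  rw [Finset.sum_congr rfl h3, Finset.sum_const, nsmul_eq_mul] at h2
  have hv0 : 0 < volume.real (ball (0 : EuclideanSpace ℝ (Fin 3)) 1) :=
    ENNReal.toReal_pos (measure_ball_pos volume _ one_pos).ne' measure_ball_lt_top.ne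
  have h4 : (R - 1) ^ 3 * volume.real (ball (0 : EuclideanSpace ℝ (Fin 3)) 1)
      ≤ (W.card : ℝ) * volume.real (ball (0 : EuclideanSpace ℝ (Fin 3)) 1) := by
    rw [h1] at hvol
    linarith only [hvol, h2]
  exact le_of_mul_le_mul_right h4 hv0

/-- The density floor when the WINDOW ITSELF meets the configuration (`R ≥ 1`, so `R ≤ 2R − 1`). [folklore] -/
theorem card_window_ge_of_voidFree' {N : ℕ} (y : Fin N → EuclideanSpace ℝ (Fin 3)) (c : EuclideanSpace ℝ (Fin 3)) {R : ℝ}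
    (hR : 1 ≤ R)
    (hv : ∀ i : Fin N, dist (y i) c ≤ 2 * R → ∀ x : EuclideanSpace ℝ (Fin 3), dist x (y i) ≤ 2 → ∃ j : Fin N, dist x (y j) < 1)
    (h0 : ∃ i : Fin N, dist (y i) c ≤ R) :
    (R - 1) ^ 3 ≤ ((Finset.univ.filter fun i : Fin N => dist (y i) c ≤ R).card : ℝ) := by
  obtain ⟨i, hi⟩ := h0
  exact card_window_ge_of_voidFree y c hR hv ⟨i, by linarith⟩

/-- The route's literal hypothesis «no particle of the doubled window is 2-void-adjacent» IS void-freeness in the sense above. -/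
theorem voidFree_of_not_mem_filter {N : ℕ} (y : Fin N → EuclideanSpace ℝ (Fin 3)) (c : EuclideanSpace ℝ (Fin 3)) {ρ : ℝ}
    (hv : ∀ i : Fin N, dist (y i) c ≤ 2 * ρ →
      i ∉ (Finset.univ.filter fun i : Fin N =>
        ∃ x : EuclideanSpace ℝ (Fin 3), dist x (y i) ≤ 2 ∧ ∀ j : Fin N, 1 ≤ dist x (y j))) :
    ∀ i : Fin N, dist (y i) c ≤ 2 * ρ → ∀ x : EuclideanSpace ℝ (Fin 3), dist x (y i) ≤ 2 → ∃ j : Fin N, dist x (y j) < 1 := by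
  intro i hi x hx
  have h := hv i hi
  rw [Finset.mem_filter, not_and] at h
  have h' := h (Finset.mem_univ _)
  push Not at h'
  exact h' x hx

/-- **DENSITY FLOOR, route spelling.**  On a window `B(c,R)`, `R ≥ 1`, whose doubled ball is 2-void-free in the literal sense of the
ContactSaturationLadder stub texts and which meets the configuration: `(R − 1)³ ≤ #B(c,R)`. [folklore] -/
theorem card_window_ge_of_not_voidAdj {N : ℕ} (y : Fin N → EuclideanSpace ℝ (Fin 3)) (c : EuclideanSpace ℝ (Fin 3)) {R : ℝ}
    (hR : 1 ≤ R)
    (hv : ∀ i : Fin N, dist (y i) c ≤ 2 * R →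
      i ∉ (Finset.univ.filter fun i : Fin N =>
        ∃ x : EuclideanSpace ℝ (Fin 3), dist x (y i) ≤ 2 ∧ ∀ j : Fin N, 1 ≤ dist x (y j)))
    (h0 : ∃ i : Fin N, dist (y i) c ≤ R) :
    (R - 1) ^ 3 ≤ ((Finset.univ.filter fun i : Fin N => dist (y i) c ≤ R).card : ℝ) :=
  card_window_ge_of_voidFree' y c hR (voidFree_of_not_mem_filter y c hv) h0

/-- The EMPTY alternative: if the window does not meet the configuration its count is `0` (so window statements of the form
`κ · #B(c,R) ≤ Σ_{B(c,R)} …` hold trivially there); recorded for the case split provers make before invoking the floor. -/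
theorem card_window_eq_zero_of_forall_lt {N : ℕ} (y : Fin N → EuclideanSpace ℝ (Fin 3)) (c : EuclideanSpace ℝ (Fin 3)) {R : ℝ}
    (h : ∀ i : Fin N, R < dist (y i) c) : (Finset.univ.filter fun i : Fin N => dist (y i) c ≤ R).card = 0 := by
  rw [Finset.card_eq_zero, Finset.filter_eq_empty_iff]
  exact fun i _ hi => absurd hi (not_le.2 (h i))

/-! ## §3 The sandwich with a separation -/

/-- **SANDWICH.**  Void-freeness on `B(c,2R)` (window meets the configuration, `R ≥ 1`) and a separation `δ > 0` among the particles of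
the outer window `B(c,R′)`, `R ≤ R′`: `(R − 1)³ · #B(c,R′) ≤ (2R′/δ + 1)³ · #B(c,R)` — outer windows and collars cost at most a constant
factor over the inner window (packing `ContactSaturationLadderHoleDepth.card_le_of_sep_of_dist_le` over the floor above). [folklore] -/
theorem card_outer_le_mul_card_inner {N : ℕ} (y : Fin N → EuclideanSpace ℝ (Fin 3)) (c : EuclideanSpace ℝ (Fin 3)) {R R' δ : ℝ}
    (hR : 1 ≤ R) (hRR' : R ≤ R') (hδ : 0 < δ)
    (hv : ∀ i : Fin N, dist (y i) c ≤ 2 * R → ∀ x : EuclideanSpace ℝ (Fin 3), dist x (y i) ≤ 2 → ∃ j : Fin N, dist x (y j) < 1)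
    (h0 : ∃ i : Fin N, dist (y i) c ≤ R)
    (hsep : ∀ i j : Fin N, i ≠ j → dist (y i) c ≤ R' → dist (y j) c ≤ R' → δ ≤ dist (y i) (y j)) :
    (R - 1) ^ 3 * ((Finset.univ.filter fun i : Fin N => dist (y i) c ≤ R').card : ℝ)
      ≤ (2 * R' / δ + 1) ^ 3 * ((Finset.univ.filter fun i : Fin N => dist (y i) c ≤ R).card : ℝ) := by
  have hlo := card_window_ge_of_voidFree' y c hR hv h0
  have hhi : ((Finset.univ.filter fun i : Fin N => dist (y i) c ≤ R').card : ℝ) ≤ (2 * R' / δ + 1) ^ 3 :=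
    ContactSaturationLadderHoleDepth.card_le_of_sep_of_dist_le y _ c hδ (by linarith)
      (fun i hi => (Finset.mem_filter.1 hi).2)
      (fun i hi j hj hij => hsep i j hij (Finset.mem_filter.1 hi).2 (Finset.mem_filter.1 hj).2)
  calc (R - 1) ^ 3 * ((Finset.univ.filter fun i : Fin N => dist (y i) c ≤ R').card : ℝ)
      ≤ ((Finset.univ.filter fun i : Fin N => dist (y i) c ≤ R).card : ℝ) * (2 * R' / δ + 1) ^ 3 :=
        mul_le_mul hlo hhi (Nat.cast_nonneg _) (Nat.cast_nonneg _)
    _ = (2 * R' / δ + 1) ^ 3 * ((Finset.univ.filter fun i : Fin N => dist (y i) c ≤ R).card : ℝ) := by ring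

/-- The sandwich for a Lennard-Jones GROUND STATE, with the universal separation of `SeparationCeilingDoor.sepGS_pos`:
SOME constant `A(R, R′)`-free form — `∃ δ > 0` such that for every ground state, every void-free window meeting the configuration,
`(R − 1)³ · #B(c,R′) ≤ (2R′/δ + 1)³ · #B(c,R)`. [folklore] -/
theorem exists_sep_card_outer_le_mul_card_inner :
    ∃ δ : ℝ, 0 < δ ∧ ∀ (N : ℕ) (y : Fin N → EuclideanSpace ℝ (Fin 3)),
      Literature.MathematicalPhysics.StatisticalMechanics.IsGroundState
          Literature.MathematicalPhysics.StatisticalMechanics.lennardJones y →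
        ∀ (c : EuclideanSpace ℝ (Fin 3)) (R R' : ℝ), 1 ≤ R → R ≤ R' →
          (∀ i : Fin N, dist (y i) c ≤ 2 * R →
              ∀ x : EuclideanSpace ℝ (Fin 3), dist x (y i) ≤ 2 → ∃ j : Fin N, dist x (y j) < 1) →
            (∃ i : Fin N, dist (y i) c ≤ R) →
              (R - 1) ^ 3 * ((Finset.univ.filter fun i : Fin N => dist (y i) c ≤ R').card : ℝ)
                ≤ (2 * R' / δ + 1) ^ 3 * ((Finset.univ.filter fun i : Fin N => dist (y i) c ≤ R).card : ℝ) := by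
  obtain ⟨δ, hδ, hS⟩ := SeparationCeilingDoor.sepGS_pos
  exact ⟨δ, hδ, fun N y hy c R R' hR hRR' hv h0 =>
    card_outer_le_mul_card_inner y c hR hRR' hδ hv h0 fun i j hij _ _ => hS N y hy i j hij⟩

end Summit.AtomisticToContinuum.Crystallization.Theorems.ContactSaturationLadderDensityFloor
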